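import Mathlib
import Summits.Ventures.PercRepro2.LocRows
import Summits.Ventures.PercRepro2.SwRow
import Summits.Ventures.PercRepro2.SwOut
import Summits.Ventures.PercRepro2.SwAllRow
import Summits.Ventures.PercRepro2.SwOutAll
import Summits.Ventures.PercRepro2.SwOutJunctionH1EdgeDefs

/-!
# The edge `h–u` by subdivision with an outside edge: the uniform lift sees the class
(blind cell PercRepro2, night-4 g29, 2026-08-28; proofs/NIGHT4-G29.md §1)

The uniform lift `ulift ζ` of a configuration `ζ` of `G` (`h–w` and `w–u` coloured like `e₀`, `w–l`
the other colour) sees exactly what `ζ` sees: its hull of `some h` is the hull of `h` with `w`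
(`some_mem_hull_ulift_iff`, `none_mem_hull_ulift`, `hull_ulift_subset_iff`), it lies in the class
`(U⁺, ulift ξ)` iff `ζ` lies in `(U, ξ)` (`mem_outClass_ulift_iff`), on the side `Q⁺` iff `ζ` is on
`Q` (`mem_tgtU_ulift_iff`, `mem_swOutSide_ulift_iff`), and its rigid edge sets are the pushes of
those of `ζ` (`redEdges_ulift`, `blueEdges_ulift`).
-/

namespace Summit.Ventures.PercRepro2

namespace LocRows

open Hull

variable {V : Type*} {E : Type*}

/-! ## The uniform lift: hull, class, side, edge sets -/

section Uniform

variable [DecidableEq E] {ends : E → Sym2 V} {e₀ : E} {h u l : V} {ζ : Config E}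

omit [DecidableEq E] in
/-- The uniform lift satisfies the colour condition of the transport. -/
lemma ulift_hd (ζ : Config E) : (!ζ e₀) = true → ζ e₀ = false := by
  cases ζ e₀ <;> simp

variable (he₀ : ends e₀ = s(h, u))
include he₀

/-- The red cluster transport for the uniform lift. -/
theorem some_mem_cluster_ulift_iff {x v : V} :
    some v ∈ cluster (subdEnds ends e₀ h u l) (ulift e₀ ζ) (some x) ↔ v ∈ cluster ends ζ x :=
  some_mem_cluster_subdLift_iff he₀ (ulift_hd ζ)

/-- The blue cluster transport for the uniform lift. -/
theorem some_mem_cluster_blue_ulift_iff {x v : V} :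
    some v ∈ cluster (subdEnds ends e₀ h u l) (blue (ulift e₀ ζ)) (some x) ↔
      v ∈ cluster ends (blue ζ) x := by
  rw [blue_ulift]
  exact some_mem_cluster_subdLift_iff he₀ (ulift_hd (blue ζ))

/-- `w` is in the red cluster of `some x` of the uniform lift iff `e₀` is red and `h` is in the
cluster of `x`, or `e₀` is blue and `l` is. -/
theorem none_mem_cluster_ulift_iff {x : V} :
    (none : Option V) ∈ cluster (subdEnds ends e₀ h u l) (ulift e₀ ζ) (some x) ↔
      (ζ e₀ = true ∧ h ∈ cluster ends ζ x) ∨ (ζ e₀ = false ∧ l ∈ cluster ends ζ x) := by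
  rw [ulift, none_mem_cluster_subdLift_iff he₀ (ulift_hd ζ)]
  unfold subdWIn
  cases ζ e₀ <;> simp

/-- `w` lies in the hull of `h` of every uniform lift. -/
lemma none_mem_hull_ulift : (none : Option V) ∈ hull (subdEnds ends e₀ h u l) (ulift e₀ ζ) (some h) := by
  cases hc : ζ e₀
  · right
    rw [blue_ulift, ulift, none_mem_cluster_subdLift_iff he₀ (ulift_hd (blue ζ))]
    left
    exact ⟨by simp [blue, hc], mem_cluster_self _ _ _⟩
  · left
    rw [none_mem_cluster_ulift_iff he₀]
    exact Or.inl ⟨hc, mem_cluster_self _ _ _⟩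

/-- A vertex of `G` is in the hull of `some x` of the uniform lift iff it is in the hull of `x`. -/
theorem some_mem_hull_ulift_iff {x v : V} :
    some v ∈ hull (subdEnds ends e₀ h u l) (ulift e₀ ζ) (some x) ↔ v ∈ hull ends ζ x := by
  simp only [hull, Set.mem_union, some_mem_cluster_ulift_iff he₀, some_mem_cluster_blue_ulift_iff he₀]

/-- The hull of `some h` of the uniform lift lies in `U⁺` iff the hull of `h` lies in `U`. -/
theorem hull_ulift_subset_iff {U : Set V} :
    hull (subdEnds ends e₀ h u l) (ulift e₀ ζ) (some h) ⊆ subdRegion U ↔ hull ends ζ h ⊆ U := by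
  constructor
  · intro hsub v hv
    have := hsub ((some_mem_hull_ulift_iff he₀).2 hv)
    simpa using this
  · intro hsub y hy
    rcases y with _ | v
    · exact none_mem_subdRegion
    · rw [some_mem_subdRegion_iff]
      exact hsub ((some_mem_hull_ulift_iff he₀).1 hy)

/-- An edge of `G⁺` touches `U⁺` iff it is the copy of an edge of `G` touching `U` or one of the
three edges at `w`. -/
lemma mem_touches_subdRegion_iff {U : Set V} (hh : h ∈ U) (e : E ⊕ Bool) :
    e ∈ touches (subdEnds ends e₀ h u l) (subdRegion U) ↔
      (∃ e', e = Sum.inl e' ∧ e' ∈ touches ends U) ∨ ∃ b, e = Sum.inr b := by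
  rcases e with e | b
  · by_cases hee : e = e₀
    · subst hee
      simp only [Sum.inl.injEq, exists_eq_left', reduceCtorEq, exists_false, or_false]
      constructor
      · intro _
        exact ⟨h, hh, u, he₀⟩
      · intro _
        exact ⟨some h, by simpa using hh, none, by simp⟩
    · simp only [Sum.inl.injEq, exists_eq_left', reduceCtorEq, exists_false, or_false]
      obtain ⟨p, q, hpq⟩ := exists_pair_eq (ends e)
      rw [mem_touches_iff_of_ends (subdEnds_inl_of_ne hee |>.trans (by rw [hpq, Sym2.map_mk])),
        mem_touches_iff_of_ends hpq]
      simp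
  · constructor
    · intro _
      exact Or.inr ⟨b, rfl⟩
    · intro _
      cases b
      · exact ⟨none, none_mem_subdRegion, some u, by simp⟩
      · exact ⟨none, none_mem_subdRegion, some l, by simp⟩

end Uniform

/-! ## The uniform lift: the class and the side -/

section UniformClass

variable [DecidableEq E] [Fintype E] {ends : E → Sym2 V} {e₀ : E} {h u l : V} {ζ : Config E}
  (he₀ : ends e₀ = s(h, u))
include he₀

/-- **The outside class transports**: the uniform lift of `ζ` lies in the class `(U⁺, ulift ξ)` iff
`ζ` lies in the class `(U, ξ)` (for `h ∈ U`). -/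
theorem mem_outClass_ulift_iff {U : Set V} {ξ : Config E} (hh : h ∈ U) :
    ulift e₀ ζ ∈ outClass (subdEnds ends e₀ h u l) (subdRegion U) (some h) (ulift e₀ ξ) ↔
      ζ ∈ outClass ends U h ξ := by
  rw [mem_outClass, mem_outClass, hull_ulift_subset_iff he₀]
  constructor
  · rintro ⟨hag, hsub⟩
    refine ⟨fun e he => ?_, hsub⟩
    have := hag (Sum.inl e) (by
      rw [mem_touches_subdRegion_iff he₀ hh]
      rintro (⟨e', he', hte'⟩ | ⟨b, hb⟩)
      · exact he (Sum.inl.inj he' ▸ hte')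
      · exact absurd hb (by simp))
    simpa using this
  · rintro ⟨hag, hsub⟩
    refine ⟨fun e he => ?_, hsub⟩
    rw [mem_touches_subdRegion_iff he₀ hh] at he
    rcases e with e | b
    · simp only [ulift_inl]
      apply hag
      intro hte
      exact he (Or.inl ⟨e, rfl, hte⟩)
    · exact absurd (Or.inr ⟨b, rfl⟩) he

/-- **The side `Q` transports.** -/
theorem mem_tgtU_ulift_iff {o : V} :
    ulift e₀ ζ ∈ tgtU (subdEnds ends e₀ h u l) (some l) (some h) {S : Set (Option V) | some o ∈ S} ↔
      ζ ∈ tgtU ends l h {S : Set V | o ∈ S} := by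
  simp only [tgtU, Finset.mem_filter, Finset.mem_univ, true_and, Set.mem_setOf_eq,
    some_mem_hull_ulift_iff he₀, some_mem_cluster_ulift_iff he₀, some_mem_cluster_blue_ulift_iff he₀]

/-- **The `Q`-class transports.** -/
theorem mem_swOutSide_ulift_iff {U : Set V} {ξ : Config E} {o : V} (hh : h ∈ U) :
    ulift e₀ ζ ∈ swOutSide (subdEnds ends e₀ h u l) (some l) (some h) (some o) (subdRegion U)
        (ulift e₀ ξ) ↔
      ζ ∈ swOutSide ends l h o U ξ := by
  rw [mem_swOutSide, mem_swOutSide, mem_tgtU_ulift_iff he₀, mem_outClass_ulift_iff he₀ hh]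

end UniformClass

/-! ## The uniform lift: the rigid edge sets -/

section UniformEdges

variable [DecidableEq E] {ends : E → Sym2 V} {e₀ : E} {h u l : V} {ζ : Config E}
  (he₀ : ends e₀ = s(h, u))
include he₀

omit [DecidableEq E] in
/-- `e₀` is a red edge of the red cluster of `h` iff it is red. -/
lemma e₀_mem_redEdges_iff : e₀ ∈ redEdges ends ζ h ↔ ζ e₀ = true := by
  constructor
  · exact fun he => he.1
  · intro he
    refine ⟨he, h, mem_cluster_self _ _ _, u, ?_, he₀⟩
    exact mem_cluster_of_edge (mem_cluster_self _ _ _) he he₀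

/-- **The rigid edge set transports**: the red edges of the red cluster of `some h` of the uniform
lift are the push of those of `ζ` (when `l` is not in the red cluster of `h`). -/
theorem redEdges_ulift (hl : l ∉ cluster ends ζ h) :
    redEdges (subdEnds ends e₀ h u l) (ulift e₀ ζ) (some h) = subdPush e₀ (redEdges ends ζ h) := by
  ext e
  rcases e with e | b
  · rw [mem_subdPush_inl_iff]
    by_cases hee : e = e₀
    · rw [hee, e₀_mem_redEdges_iff he₀]
      constructor
      · exact fun h' => h'.1
      · intro hred
        refine ⟨hred, some h, mem_cluster_self _ _ _, none, ?_, by simp⟩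
        rw [none_mem_cluster_ulift_iff he₀]
        exact Or.inl ⟨hred, mem_cluster_self _ _ _⟩
    · obtain ⟨p, q, hpq⟩ := exists_pair_eq (ends e)
      have hsub : subdEnds ends e₀ h u l (Sum.inl e) = s(some p, some q) := by
        rw [subdEnds_inl_of_ne hee, hpq, Sym2.map_mk]
      constructor
      · rintro ⟨hred, x, hx, y, hy, hxy⟩
        refine ⟨hred, ?_⟩
        rw [hsub, Sym2.eq_iff] at hxy
        rcases hxy with ⟨rfl, rfl⟩ | ⟨rfl, rfl⟩
        · exact ⟨p, (some_mem_cluster_ulift_iff he₀).1 hx, q, (some_mem_cluster_ulift_iff he₀).1 hy,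
            hpq⟩
        · exact ⟨q, (some_mem_cluster_ulift_iff he₀).1 hx, p, (some_mem_cluster_ulift_iff he₀).1 hy,
            ends_swap hpq⟩
      · rintro ⟨hred, x, hx, y, hy, hxy⟩
        refine ⟨hred, ?_⟩
        rw [hpq, Sym2.eq_iff] at hxy
        rcases hxy with ⟨h1, h2⟩ | ⟨h1, h2⟩
        · exact ⟨some x, (some_mem_cluster_ulift_iff he₀).2 hx, some y,
            (some_mem_cluster_ulift_iff he₀).2 hy, by rw [hsub, h1, h2]⟩
        · exact ⟨some x, (some_mem_cluster_ulift_iff he₀).2 hx, some y,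
            (some_mem_cluster_ulift_iff he₀).2 hy, by rw [hsub, h1, h2, Sym2.eq_swap]⟩
  · cases b
    · rw [mem_subdPush_inr_false_iff, e₀_mem_redEdges_iff he₀]
      constructor
      · exact fun h' => h'.1
      · intro hred
        refine ⟨hred, none, ?_, some u, ?_, by simp⟩
        · rw [none_mem_cluster_ulift_iff he₀]
          exact Or.inl ⟨hred, mem_cluster_self _ _ _⟩
        · rw [some_mem_cluster_ulift_iff he₀]
          exact mem_cluster_of_edge (mem_cluster_self _ _ _) hred he₀
    · constructor
      · rintro ⟨_, x, hx, y, hy, hxy⟩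
        exfalso
        rw [subdEnds_inr_true, Sym2.eq_iff] at hxy
        rcases hxy with ⟨rfl, rfl⟩ | ⟨rfl, rfl⟩
        · exact hl ((some_mem_cluster_ulift_iff he₀).1 hy)
        · exact hl ((some_mem_cluster_ulift_iff he₀).1 hx)
      · intro h'
        exact absurd h' not_mem_subdPush_inr_true

/-- **The blue rigid edge set transports.** -/
theorem blueEdges_ulift (hl : l ∉ cluster ends (blue ζ) h) :
    blueEdges (subdEnds ends e₀ h u l) (ulift e₀ ζ) (some h) = subdPush e₀ (blueEdges ends ζ h) := by
  unfold blueEdges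
  rw [blue_ulift]
  exact redEdges_ulift he₀ hl

end UniformEdges


end LocRows

end Summit.Ventures.PercRepro2
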